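import Literature.NumberTheory.Automorphic.RamakrishnanMultiplicityOneDihedral
import Literature.NumberTheory.Automorphic.RamakrishnanMultiplicityOneSL2Reductions
import Literature.NumberTheory.Automorphic.PairLFunctionPolesRepDataBoundaryAssembly
import Literature.NumberTheory.Automorphic.PairLFunctionPolesEqConjLandau
import HarnessLib

/-!
# Ramakrishnan, Thm. 4.1.2: the leaves below `Ramakrishnan2000_multiplicityOneSL2_holds` (proof file)

Topic `NumberTheory/Automorphic`; namespace `Literature.NumberTheory.Automorphic`. Proof file
(theorems only: no definition, no named fact, no instance, no `sorry`) next to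
`RamakrishnanTensorProductGL2` (the named fact `Ramakrishnan2000_multiplicityOneSL2` — D. Ramakrishnan,
*Modularity of the Rankin–Selberg `L`-series, and multiplicity one for `SL(2)`*, Ann. of Math. (2)
152 (2000), 45–111, **Thm. 4.1.2**: "Let `π, π'` be unitary, cuspidal automorphic representations of
`GL(2, 𝔸_F)`. Suppose `Ad(π_v) ≃ Ad(π'_v)` for almost all `v`. Then there exists an idele class
character `χ` … such that `π' ≃ π ⊗ χ`"), after `RamakrishnanTensorProductGL2Proofs`,
`RamakrishnanMultiplicityOneLemma414`, `RamakrishnanMultiplicityOneDihedral` (the printed proof of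
§4.1, pp. 37–39, formalised modulo named facts: `Ramakrishnan2000_multiplicityOneSL2.of_named_facts`,
thirteen hypotheses) and `RamakrishnanMultiplicityOneSL2Reductions` (only the cuspidal case
`Ramakrishnan2000_boxTimes_cuspidal` of Theorem M is used).

Since those files were written the tree has PROVED a number of their hypotheses; this file feeds
the proofs in and records what is left. Discharged here:

* Jacquet–Shalika (2.1) for Borel–Jacquet data (`JacquetShalika1981_multipliable_partialPairL_repData_holds`,
  `PairLFunctionPolesRepDataHolds`), and the reductions of (2.3), (2.2) for Borel–Jacquet data to their
  `L²` forms (`JacquetShalika1981_partialPairL_pole_repData_of_pole_of_eq_conj`,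
  `JacquetShalika1981_partialPairL_boundary_repData_of_L2_leaves`, loc. cit.);
* the whole Borel–Jacquet dictionary between cuspidal data and `L²_cusp` — the hypotheses `hAss`
  (`AutomorphicRepsGL.exists_isAssociatedL2`), `hL2` (`hasSatakeParamAt_iff_L2`) and `hss`
  (`AutomorphicRepsGL.stable_cuspidal_eq_sSup_irreducible`) of `…dihedral_of_AC` / `…of_named_facts`:
  the unitary normalisation `t_{π,w} = q_w^{s} α_P(w)` of a cuspidal datum is now the theorem
  `CuspidalAutomorphicRepData.exists_satake_eq_cpow_mul_L2_unconditional` (Borel–Jacquet 1979, 5.7;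
  `AutomorphicInductionCuspidalProofs`) and the central character of a cuspidal datum the theorem
  `exists_heckeCharacter_prod_satake'` (`CuspidalDescentDetCubicRepData`), so `hL2` is not needed
  at all (only the direction datum `↦ L²` of the agreement of Satake parameters enters, a theorem);
* Theorem M is needed only in its cuspidal case (`Ramakrishnan2000_boxTimes_cuspidal`, through
  `Ramakrishnan2000_multiplicityOneSL2.of_boxTimes_cuspidal_of_JS` of
  `RamakrishnanMultiplicityOneSL2Reductions`).

## What is proved here

* `Ramakrishnan2000_multiplicityOneSL2.dihedral_of_AC_of_L2` — the both-dihedral case `hdih` of the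
  printed proof (op. cit. p. 38) from: Tate's continuation of Hecke `L`-functions `hT`,
  Arthur–Clozel Thm. 4.2 (b) on `GL(2)` `hAC`, multiplicity one `hm1` and Jacquet–Shalika
  (2.2)–(2.3) in `L²` `h22`, `h23` on `GL(2)/F` — the proof of
  `Ramakrishnan2000_multiplicityOneSL2.dihedral_of_AC` verbatim with the normalisation step
  unconditional.
* `Ramakrishnan2000_multiplicityOneSL2.of_L2_leaves` — **Thm. 4.1.2 from the remaining leaves**:
  (a) `Ramakrishnan2000_boxTimes_cuspidal` (Theorem M, cuspidal case); (b) `GelbartJacquet_adjoint_lift`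
  (Gelbart–Jacquet (9.3)); (c) `ArthurClozel1989_inducedLift_of_twist_eq 2 F E` (Arthur–Clozel
  Thm. 4.2 (b)); (d) `multiplicity_one_gl` (Shalika); (e) Jacquet–Shalika (2.2)–(2.3) in `L²_cusp`:
  `JacquetShalika1981_partialPairL_at_one_of_ne_conj`, `…_boundary_of_ne_one`, `…_at_one_of_rank_ne`,
  `…_pole_of_eq_conj`; (f) Tate's theorem `heckeLFunction_hasEntireContinuation_of_not_isNormTwist`.
  `Ramakrishnan2000_multiplicityOneSL2_holds` is this theorem fed with the discharges of (a)–(f).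
* `Ramakrishnan2000_multiplicityOneSL2.of_MW_leaves` — the same with (e) replaced by the three
  Mœglin–Waldspurger continuation facts of `PairLFunctionMeromorphicContinuation` (Appendice,
  Corollaire (i)(a) `MoeglinWaldspurger1989_partialPairL_entire_of_rank_ne`, (i)(b)
  `…_entire_of_ne_conj`, (ii) `…_of_eq_conj`), along which the tree proves the `L²` forms of
  (2.2)–(2.3) (`…_of_moeglinWaldspurger`, `PairLFunctionPolesRankNeLandau`, `PairLFunctionPolesEqConjLandau`,
  `PairLFunctionBoundaryAssembly`: non-vanishing on `Re s = 1` by de la Vallée Poussin–Landau).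

## References

* D. Ramakrishnan, *Modularity of the Rankin–Selberg `L`-series, and multiplicity one for
  `SL(2)`*, Ann. of Math. (2) 152 (2000), 45–111, §4.1, Thm. 4.1.2 and its proof (pp. 37–39),
  Lemma 4.1.4. [Ramakrishnan2000]
* J. Arthur, L. Clozel, *Simple algebras, base change, and the advanced theory of the trace
  formula*, Ann. of Math. Stud. 120 (1989), Ch. 3 §2 (2.1)–(2.3), Thm. 4.2 (b). [ArthurClozelAMS120]
* A. Borel, H. Jacquet, *Automorphic forms and automorphic representations*, Proc. Sympos. Pure
  Math. 33 (1979), part 1, §4.6 and 5.7. [BorelJacquetCorvallis1979]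
* J. Tate, *Fourier analysis in number fields and Hecke's zeta-functions*, in Cassels–Fröhlich,
  *Algebraic Number Theory* (1967), Ch. XV, Thm. 4.4.1. [TateThesis1967]
* C. Mœglin, J.-L. Waldspurger, *Le spectre résiduel de `GL(n)`*, Ann. Sci. ÉNS (4) 22 (1989),
  605–674: Appendice, Corollaire (i)(a), (i)(b), (ii), p. 667. [MoeglinWaldspurger1989]
-/

noncomputable section

open scoped Topology NNReal
open NumberField IsDedekindDomain MeasureTheory Filter Complex Set
open Literature.NumberTheory.GaloisRepresentations

namespace Literature.NumberTheory.Automorphic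

open AdelicGroupData

section Dihedral

variable {F : Type} [Field F] [NumberField F]

/-- Cancel a non-zero scalar: `β.map (d * ·) = γ` gives `β = γ.map (d⁻¹ * ·)`. [folklore] -/
private theorem eq_map_inv_mul_of_map_mul_eq_lv {β γ : Multiset ℂ} {d : ℂ} (hd : d ≠ 0)
    (h : β.map (d * ·) = γ) : β = γ.map (d⁻¹ * ·) := by
  rw [← h, Multiset.map_map]
  conv_lhs => rw [← Multiset.map_id β]
  refine Multiset.map_congr rfl fun x _ => ?_
  simp only [Function.comp_apply, id_eq]
  rw [← mul_assoc, inv_mul_cancel₀ hd, one_mul]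

/-- `q_v^s ≠ 0`. [folklore] -/
private theorem residueCard_cpow_ne_zero_lv (v : HeightOneSpectrum (𝓞 F)) (s : ℂ) :
    ((v.residueCard : ℂ) ^ s) ≠ 0 := by
  intro h
  have h1 := (Complex.cpow_eq_zero_iff _ _).1 h
  have h2 : (v.residueCard : ℂ) ≠ 0 := by
    have := v.one_lt_residueCard
    exact_mod_cast (by omega : v.residueCard ≠ 0)
  exact h2 h1.1

/-- **The both-dihedral case of Thm. 4.1.2, with the Borel–Jacquet dictionary discharged** — the
hypothesis `hdih` of `Ramakrishnan2000_multiplicityOneSL2.of_theoremM` /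
`…of_boxTimes_cuspidal` (printed proof, op. cit. p. 38: "`π, π'` both dihedral … `π = I_K^F(μ)`,
`π' = I_K^F(μ')` … `μ' = μ χ_K` … `π' ≅ π ⊗ χ`"). For cuspidal data `π, π'` on `GL(2)/F` with `(LL)`
and non-trivial self-twists: the self-twist `δ` of `π` is quadratic
(`IsSatakeSelfTwist.exists_pow_eq_one`) and twists `π'` too (`isSatakeTwistBy_self_of_LL_right`);
`δ = η_{E/F}` for a quadratic `E` (`HeckeCharacter.exists_isClassFieldCharacter_of_sq_eq_one`, class
field theory); in the unitary `L²` normalisation `t_π = q^s α_P` — here the THEOREM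
`CuspidalAutomorphicRepData.exists_satake_eq_cpow_mul_L2_unconditional` (Borel–Jacquet 1979, 5.7, over
the discharged dictionary leaves) instead of the three hypotheses `hAss`, `hL2`, `hss` of
`Ramakrishnan2000_multiplicityOneSL2.dihedral_of_AC` — `P ⊗ δ = P`
(`twistByFiniteOrderChar_eq_self_of_isSatakeTwistBy`: multiplicity one `hm1` and Jacquet–Shalika
`h22`, `h23` over `F`), so `P`, `P'` are induced from Hecke characters `μ, μ'` of `E`
(`exists_inducing_heckeCharacters_of_twist_eq`, Arthur–Clozel Thm. 4.2 (b) `hAC`); the model-free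
core `Ramakrishnan2000_dihedral_core` (Tate's continuation `hT` over `E`, Hilbert 90) gives
`α_{P'} = χ(ϖ_v) α_P` a.e., and untwisting the normalisations `t_{π'} = (χ ‖·‖^{s-s'})(ϖ_v) t_π` a.e.
Otherwise the proof of `…dihedral_of_AC` verbatim.
[cite: Ramakrishnan2000, §4.1, proof of Thm. 4.1.2 (p. 38)] [cite: BorelJacquetCorvallis1979, §5.7] -/
theorem Ramakrishnan2000_multiplicityOneSL2.dihedral_of_AC_of_L2
    (hT : ∀ (E : Type) [Field E] [NumberField E] (χ : HeckeCharacter E),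
      heckeLFunction_hasEntireContinuation_of_not_isNormTwist χ)
    (hAC : ∀ (F E : Type) [Field F] [NumberField F] [Field E] [NumberField E] [Algebra F E]
      [FiniteDimensional F E], ArthurClozel1989_inducedLift_of_twist_eq 2 F E)
    (hm1 : ∀ (F : Type) [Field F] [NumberField F] (μ : Measure (gl 2 F).automorphicQuotient)
      [(gl 2 F).IsAutomorphicMeasure μ], multiplicity_one_gl 2 F μ)
    (h22 : ∀ (F : Type) [Field F] [NumberField F] (μ : Measure (gl 2 F).automorphicQuotient)
      [(gl 2 F).IsAutomorphicMeasure μ],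
      JacquetShalika1981_partialPairL_at_one_of_ne_conj (n := 2) (K := F) (μ := μ))
    (h23 : ∀ (F : Type) [Field F] [NumberField F] (μ : Measure (gl 2 F).automorphicQuotient)
      [(gl 2 F).IsAutomorphicMeasure μ],
      JacquetShalika1981_partialPairL_pole_of_eq_conj (n := 2) (K := F) (μ := μ))
    (F : Type) [Field F] [NumberField F] (h2 : isCompact_glFiniteIntegralLevel 2 F)
    (π π' : CuspidalAutomorphicRepData 2 F h2)
    (hLL : ∀ᶠ v : HeightOneSpectrum (𝓞 F) in cofinite, ∃ (α : Multiset ℂ) (c : ℂ), c ≠ 0 ∧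
      π.1.HasSatakeParamAt v α ∧ π'.1.HasSatakeParamAt v (α.map (c * ·)))
    (hπ : IsSatakeSelfTwist π.1) (_hπ' : IsSatakeSelfTwist π'.1) :
    ∃ χ : HeckeCharacter F, IsSatakeTwistBy π.1 π'.1 χ := by
  classical
  -- the quadratic character `δ` twisting both `π` and `π'`, and its field `E`
  obtain ⟨δ, hδ1, hδ2, hδ⟩ := hπ.exists_pow_eq_one
  have hδ' : IsSatakeTwistBy π'.1 π'.1 δ := isSatakeTwistBy_self_of_LL_right π.1 π'.1 hLL hδ
  have hfo : δ.IsFiniteOrder := isOfFinOrder_iff_pow_eq_one.mpr ⟨2, two_pos, hδ2⟩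
  obtain ⟨E, _, _, _, _, hdeg, hcf⟩ := δ.exists_isClassFieldCharacter_of_sq_eq_one hδ2 hδ1
  haveI : FiniteDimensional F E := Module.finite_of_finrank_pos (by rw [hdeg]; exact two_pos)
  have hprime : (Module.finrank F E).Prime := by rw [hdeg]; exact Nat.prime_two
  have hcard : Nat.card (E ≃ₐ[F] E) = 2 := by rw [IsGalois.card_aut_eq_finrank, hdeg]
  obtain ⟨σ, hσ, -⟩ := (Nat.card_eq_two_iff' (1 : E ≃ₐ[F] E)).mp hcard
  -- the unitary `L²` normalisations of `π`, `π'` (Borel–Jacquet 5.7, unconditional)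
  obtain ⟨μ₀, hμ₀⟩ := AdelicGroupData.exists_isAutomorphicMeasure_gl_holds 2 F
  haveI := hμ₀
  haveI : NeZero (2 : ℕ) := ⟨two_ne_zero⟩
  obtain ⟨s, P, S, αP, hS, hαP, hiff⟩ :=
    CuspidalAutomorphicRepData.exists_satake_eq_cpow_mul_L2_unconditional h2 μ₀ π
  obtain ⟨s', P', S', αP', hS', hαP', hiff'⟩ :=
    CuspidalAutomorphicRepData.exists_satake_eq_cpow_mul_L2_unconditional h2 μ₀ π'
  -- `P ⊗ δ = P`, `P' ⊗ δ = P'`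
  obtain ⟨hfixP, hPP⟩ := twistByFiniteOrderChar_eq_self_of_isSatakeTwistBy (hm1 F μ₀) (h22 F μ₀)
    (h23 F μ₀) hfo π hS hαP hiff hδ
  obtain ⟨-, hPP'⟩ := twistByFiniteOrderChar_eq_self_of_isSatakeTwistBy (hm1 F μ₀) (h22 F μ₀)
    (h23 F μ₀) hfo π' hS' hαP' hiff' hδ'
  -- rewrite the twists through the class-field character proof term
  have hPP₁ : P.twistByFiniteOrderChar δ hcf.isFiniteOrder = P := hPP
  have hPP₁' : P'.twistByFiniteOrderChar δ hcf.isFiniteOrder = P' := hPP'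
  -- the inducing characters
  obtain ⟨μ, μσ, hμσ, hu, huσ, hA, hAσ, hrel⟩ :=
    exists_inducing_heckeCharacters_of_twist_eq hdeg (hAC F E) hcf P hPP₁ hαP hσ
  obtain ⟨μ', μ'σ, hμ'σ, hu', hu'σ, hA', hA'σ, hrel'⟩ :=
    exists_inducing_heckeCharacters_of_twist_eq hdeg (hAC F E) hcf P' hPP₁' hαP' hσ
  -- `(LL)` for the normalised families
  have hLLα : ∀ᶠ v : HeightOneSpectrum (𝓞 F) in cofinite,
      ∃ c : ℂ, c ≠ 0 ∧ αP' v = (αP v).map (c * ·) := by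
    filter_upwards [hLL, hS.eventually_cofinite_notMem, hS'.eventually_cofinite_notMem]
      with v hv hvS hvS'
    obtain ⟨α, c, hc, hα, hα'⟩ := hv
    have e1 := (hiff v hvS α).1 hα
    have e2 := (hiff' v hvS' _).1 hα'
    have hq := residueCard_cpow_ne_zero_lv v s
    have hq' := residueCard_cpow_ne_zero_lv v s'
    refine ⟨((v.residueCard : ℂ) ^ s')⁻¹ * c * (v.residueCard : ℂ) ^ s,
      mul_ne_zero (mul_ne_zero (inv_ne_zero hq') hc) hq, ?_⟩
    rw [eq_map_inv_mul_of_map_mul_eq_lv hq' e2.symm, e1, Multiset.map_map, Multiset.map_map]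
    refine Multiset.map_congr rfl fun x _ => ?_
    simp only [Function.comp_apply]
    ring
  -- the self-twist at the inert places: `-α_P(v) = α_P(v)`
  have hst : ∀ᶠ w : HeightOneSpectrum (𝓞 E) in cofinite, w.asIdeal.inertiaDeg (𝓞 F) = 2 →
      (αP (w.under (𝓞 F))).map (fun x => -x) = αP (w.under (𝓞 F)) := by
    have hprim := hcf.eventually_isPrimitiveRoot_valueAtUniformizer hprime
    filter_upwards [(tendsto_under_cofinite (𝓞 F)).eventually hfixP,
      (tendsto_under_cofinite (𝓞 F)).eventually hprim] with w hfw hpw hf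
    haveI iw : w.asIdeal.LiesOver (w.under (𝓞 F)).asIdeal := ⟨rfl⟩
    have hfIn : (w.under (𝓞 F)).asIdeal.inertiaDegIn (𝓞 E) = w.asIdeal.inertiaDeg (𝓞 F) :=
      Ideal.inertiaDegIn_eq_inertiaDeg (w.under (𝓞 F)).asIdeal w.asIdeal (E ≃ₐ[F] E)
    rw [hfIn, hf] at hpw
    rw [hpw.eq_neg_one_of_two_right] at hfw
    simp only [neg_one_mul] at hfw
    exact hfw
  -- the induction relations, unguarded
  have hrel₁ : ∀ᶠ w : HeightOneSpectrum (𝓞 E) in cofinite,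
      ({μ.valueAtUniformizer w} + {μσ.valueAtUniformizer w} : Multiset ℂ) =
        (αP (w.under (𝓞 F))).map (· ^ w.asIdeal.inertiaDeg (𝓞 F)) := by
    filter_upwards [hrel, (tendsto_under_cofinite (𝓞 F)).eventually hS.eventually_cofinite_notMem]
      with w hw hwS
    exact hw hwS
  have hrel₁' : ∀ᶠ w : HeightOneSpectrum (𝓞 E) in cofinite,
      ({μ'.valueAtUniformizer w} + {μ'σ.valueAtUniformizer w} : Multiset ℂ) =
        (αP' (w.under (𝓞 F))).map (· ^ w.asIdeal.inertiaDeg (𝓞 F)) := by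
    filter_upwards [hrel', (tendsto_under_cofinite (𝓞 F)).eventually hS'.eventually_cofinite_notMem]
      with w hw hwS
    exact hw hwS
  -- the core
  obtain ⟨χ, hχ⟩ := Ramakrishnan2000_dihedral_core hdeg (hT E) hσ hμσ hμ'σ hu hu' huσ hu'σ hA hA'
    hAσ hA'σ hLLα hst hrel₁ hrel₁'
  -- untwist the normalisations: `t_{π'} = χ(ϖ_v) q_v^{s'-s} t_π`
  obtain ⟨νz, hνz⟩ := exists_heckeCharacter_ideleNorm_cpow F (s - s')
  refine ⟨χ * νz, ?_⟩
  filter_upwards [hχ, hS.eventually_cofinite_notMem, hS'.eventually_cofinite_notMem]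
    with v hv hvS hvS' α hα
  have e1 := (hiff v hvS α).1 hα
  have hq := residueCard_cpow_ne_zero_lv v s
  have hq' := residueCard_cpow_ne_zero_lv v s'
  have hq0 : (v.residueCard : ℂ) ≠ 0 := by
    have := v.one_lt_residueCard
    exact_mod_cast (by omega : v.residueCard ≠ 0)
  have key : α.map ((χ * νz).valueAtUniformizer v * ·) =
      (αP' v).map (((v.residueCard : ℂ) ^ s') * ·) := by
    rw [e1, hv, HeckeCharacter.valueAtUniformizer_mul, HeckeCharacter.valueAtUniformizer_of_cpow hνz v,
      Complex.cpow_sub _ _ hq0, Multiset.map_map, Multiset.map_map]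
    refine Multiset.map_congr rfl fun x _ => ?_
    simp only [Function.comp_apply]
    rw [inv_div]
    field_simp
  rw [key]
  exact (hiff' v hvS' _).2 rfl

end Dihedral

/-! ### Thm. 4.1.2 from the remaining leaves -/

section Leaves

/-- **Ramakrishnan's Thm. 4.1.2 (`Ramakrishnan2000_multiplicityOneSL2`) from the leaves of the
tree** — the printed proof (op. cit. §4.1, pp. 37–39) with every step either proved in the tree
or one of the following named facts: (a) Theorem M in the cuspidal case
(`Ramakrishnan2000_boxTimes_cuspidal`: for a non-dihedral pair not twist-equivalent, a cuspidal
`π ⊠ π'` on `GL(4)/F` — the source of `χ`, through `…of_boxTimes_cuspidal_of_JS`); (b) Gelbart–Jacquet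
(`GelbartJacquet_adjoint_lift`: `Ad(π)` is cuspidal on `GL(3)` for non-dihedral `π`; Lemma 4.1.4);
(c) Arthur–Clozel, Ch. 3, Thm. 4.2 (b) on `GL(2)` (`ArthurClozel1989_inducedLift_of_twist_eq 2 F E`:
a cuspidal `P` with `P ⊗ η_{E/F} = P` is automorphically induced from `E`; the dihedral case);
(d) multiplicity one on `L²_cusp(GL_n)` (`multiplicity_one_gl`); (e) Jacquet–Shalika (2.2)–(2.3) in
`L²_cusp(GL_n)` (`JacquetShalika1981_partialPairL_at_one_of_ne_conj`, `…_boundary_of_ne_one`,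
`…_at_one_of_rank_ne`, `…_pole_of_eq_conj`: the analytic behaviour of `L^S(s, π × σ)` on `Re s = 1`;
Lemma 4.1.4 through `JacquetShalika1981_partialPairL_{boundary,pole}_repData_of_…`, and strong
multiplicity one in the dihedral case); (f) Tate's theorem
(`heckeLFunction_hasEntireContinuation_of_not_isNormTwist`: the dichotomy lemma of the dihedral
case). Everything else on the printed path — Jacquet–Shalika (2.1), the Borel–Jacquet dictionary
(realisation in `L²_cusp`, unitary normalisation, central characters, semisimplicity of
`𝒜_cusp^{A_G}`), class field theory for quadratic characters, Hilbert 90 for Hecke characters, the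
uniqueness of Satake parameters — is a theorem of the tree. `Ramakrishnan2000_multiplicityOneSL2_holds`
is this theorem fed with the discharges of (a)–(f).
[cite: Ramakrishnan2000, Theorem 4.1.2 and §4.1 (proof), Lemma 4.1.4]
[cite: ArthurClozelAMS120, Ch. 3 §2 (2.2)–(2.3) and Thm. 4.2 (b)] -/
theorem Ramakrishnan2000_multiplicityOneSL2.of_L2_leaves
    (hB : Ramakrishnan2000_boxTimes_cuspidal)
    (hGJ : GelbartJacquet_adjoint_lift)
    (hAC : ∀ (F E : Type) [Field F] [NumberField F] [Field E] [NumberField E] [Algebra F E]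
      [FiniteDimensional F E], ArthurClozel1989_inducedLift_of_twist_eq 2 F E)
    (hm1 : ∀ (n : ℕ) (K : Type) [Field K] [NumberField K] (μ : Measure (gl n K).automorphicQuotient)
      [(gl n K).IsAutomorphicMeasure μ], multiplicity_one_gl n K μ)
    (h22 : ∀ {n : ℕ} {K : Type} [Field K] [NumberField K] {μ : Measure (gl n K).automorphicQuotient}
      [(gl n K).IsAutomorphicMeasure μ],
      JacquetShalika1981_partialPairL_at_one_of_ne_conj (n := n) (K := K) (μ := μ))
    (h22' : ∀ {n m : ℕ} {K : Type} [Field K] [NumberField K]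
      {μ : Measure (gl n K).automorphicQuotient} [(gl n K).IsAutomorphicMeasure μ]
      {μ' : Measure (gl m K).automorphicQuotient} [(gl m K).IsAutomorphicMeasure μ'],
      JacquetShalika1981_partialPairL_boundary_of_ne_one (n := n) (m := m) (K := K) (μ := μ)
        (μ' := μ'))
    (hrk : ∀ {n m : ℕ} {K : Type} [Field K] [NumberField K]
      {μ : Measure (gl n K).automorphicQuotient} [(gl n K).IsAutomorphicMeasure μ]
      {μ' : Measure (gl m K).automorphicQuotient} [(gl m K).IsAutomorphicMeasure μ'],
      JacquetShalika1981_partialPairL_at_one_of_rank_ne (n := n) (m := m) (K := K) (μ := μ)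
        (μ' := μ'))
    (h23 : ∀ {n : ℕ} {K : Type} [Field K] [NumberField K] {μ : Measure (gl n K).automorphicQuotient}
      [(gl n K).IsAutomorphicMeasure μ],
      JacquetShalika1981_partialPairL_pole_of_eq_conj (n := n) (K := K) (μ := μ))
    (hT : ∀ (E : Type) [Field E] [NumberField E] (χ : HeckeCharacter E),
      heckeLFunction_hasEntireContinuation_of_not_isNormTwist χ) :
    Ramakrishnan2000_multiplicityOneSL2 :=
  Ramakrishnan2000_multiplicityOneSL2.of_boxTimes_cuspidal_of_JS hB
    JacquetShalika1981_multipliable_partialPairL_repData_holds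
    (JacquetShalika1981_partialPairL_boundary_repData_of_L2_leaves h22 h22' hrk hm1)
    (JacquetShalika1981_partialPairL_pole_repData_of_pole_of_eq_conj h23) hGJ
    (fun F _ _ h2 π => by
      haveI : NeZero (2 : ℕ) := ⟨two_ne_zero⟩
      exact exists_heckeCharacter_prod_satake' π)
    fun F _ _ h2 π π' hLL hπ hπ' =>
      Ramakrishnan2000_multiplicityOneSL2.dihedral_of_AC_of_L2 hT hAC (fun F _ _ μ _ => hm1 2 F μ)
        (fun F _ _ μ _ => h22) (fun F _ _ μ _ => h23) F h2 π π' hLL hπ hπ'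

/-- **Thm. 4.1.2 from the Mœglin–Waldspurger continuation facts** — `…of_L2_leaves` with the four
`L²` forms of Jacquet–Shalika (2.2)–(2.3) supplied by the tree's theorems over the continuation facts
of `PairLFunctionMeromorphicContinuation` (Mœglin–Waldspurger, Appendice, Corollaire, p. 667):
(i)(a) `hMWa` (`n ≠ m` ⇒ `L^S(s, π ⊗ σ)` entire), (i)(b) `hMWb` (`π ≇ σ̃` ⇒ entire), (ii) `hMWc`
(`s (s - 1) L^S(s, π ⊗ π̃)` entire): `JacquetShalika1981_partialPairL_at_one_of_ne_conj_of_moeglinWaldspurger`,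
`…_at_one_of_rank_ne_of_moeglinWaldspurger`, `…_pole_of_eq_conj_of_moeglinWaldspurger` (positivity and
Landau's lemma) and `…_boundary_of_ne_one_of_moeglinWaldspurger_all` (de la Vallée Poussin–Landau on
`Re s = 1`). So the named fact follows from the discharges of: `Ramakrishnan2000_boxTimes_cuspidal`,
`GelbartJacquet_adjoint_lift`, `ArthurClozel1989_inducedLift_of_twist_eq 2`, `multiplicity_one_gl`,
the three Mœglin–Waldspurger facts, and Tate's theorem.
[cite: Ramakrishnan2000, Theorem 4.1.2 and §4.1 (proof)]
[cite: MoeglinWaldspurger1989, Appendice, Corollaire (i)(a), (i)(b), (ii), p. 667] -/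
theorem Ramakrishnan2000_multiplicityOneSL2.of_MW_leaves
    (hB : Ramakrishnan2000_boxTimes_cuspidal)
    (hGJ : GelbartJacquet_adjoint_lift)
    (hAC : ∀ (F E : Type) [Field F] [NumberField F] [Field E] [NumberField E] [Algebra F E]
      [FiniteDimensional F E], ArthurClozel1989_inducedLift_of_twist_eq 2 F E)
    (hm1 : ∀ (n : ℕ) (K : Type) [Field K] [NumberField K] (μ : Measure (gl n K).automorphicQuotient)
      [(gl n K).IsAutomorphicMeasure μ], multiplicity_one_gl n K μ)
    (hMWa : ∀ {n m : ℕ} {K : Type} [Field K] [NumberField K]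
      {μ : Measure (gl n K).automorphicQuotient} [(gl n K).IsAutomorphicMeasure μ]
      {μ' : Measure (gl m K).automorphicQuotient} [(gl m K).IsAutomorphicMeasure μ'],
      MoeglinWaldspurger1989_partialPairL_entire_of_rank_ne (n := n) (m := m) (K := K) (μ := μ)
        (μ' := μ'))
    (hMWb : ∀ {n : ℕ} {K : Type} [Field K] [NumberField K] {μ : Measure (gl n K).automorphicQuotient}
      [(gl n K).IsAutomorphicMeasure μ],
      MoeglinWaldspurger1989_partialPairL_entire_of_ne_conj (n := n) (K := K) (μ := μ))
    (hMWc : ∀ {n : ℕ} {K : Type} [Field K] [NumberField K] {μ : Measure (gl n K).automorphicQuotient}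
      [(gl n K).IsAutomorphicMeasure μ],
      MoeglinWaldspurger1989_partialPairL_of_eq_conj (n := n) (K := K) (μ := μ))
    (hT : ∀ (E : Type) [Field E] [NumberField E] (χ : HeckeCharacter E),
      heckeLFunction_hasEntireContinuation_of_not_isNormTwist χ) :
    Ramakrishnan2000_multiplicityOneSL2 :=
  Ramakrishnan2000_multiplicityOneSL2.of_L2_leaves hB hGJ hAC hm1
    (fun {_} {_} _ _ {_} _ =>
      JacquetShalika1981_partialPairL_at_one_of_ne_conj_of_moeglinWaldspurger hMWb hMWc)
    (fun {_} {_} {_} _ _ {_} _ {_} _ =>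
      JacquetShalika1981_partialPairL_boundary_of_ne_one_of_moeglinWaldspurger_all hMWa hMWb hMWc hMWc
        (hm1 _ _ _))
    (fun {_} {_} {_} _ _ {_} _ {_} _ =>
      JacquetShalika1981_partialPairL_at_one_of_rank_ne_of_moeglinWaldspurger hMWa hMWc hMWc)
    (fun {_} {_} _ _ {_} _ => JacquetShalika1981_partialPairL_pole_of_eq_conj_of_moeglinWaldspurger hMWc)
    hT

end Leaves

end Literature.NumberTheory.Automorphic

end
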